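import Literature.NumberTheory.ModularForms.SiegelUnitsEisenstein
import HarnessLib

/-!
# The period cocycle of the level-raised weight-two Eisenstein series `E₂^{𝟙,ψ}(z) − E₂^{𝟙,ψ}(Mz)`
# from the winding numbers of Siegel units (Katz-free Eisenstein periods, integral by construction)

Topic `Literature/NumberTheory/ModularForms`; namespace `Literature.NumberTheory.ModularForms`,
grouping sub-namespace `EisWt2`. Sequel of `SiegelUnitsEisenstein`.

Let `ψ` be a Dirichlet character modulo `N` and `M ≥ 1`. With chosen holomorphic logarithms
`L_b = unitLog N b` of the Siegel units `𝒱_b = siegelLevel N b` (`b mod N`, `b ≠ 0`) put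

  `Λ_ψ(τ) = ∑_{b mod N} ψ(b) L_b(τ)`,  `Ψ(τ) = Λ_ψ(τ) − M⁻¹ Λ_ψ(Mτ)`.

* `unitWinding` — the **winding numbers** `m_b(g) ∈ ℤ` of the units along `g ∈ Γ₀(N)`:
  `L_b(gτ) = L_{bα}(τ) + 12πi·(bβ)(bα)/N + 2πi·m_b(g)` for `g = (α β; γ δ)` (`unitLog_smul`, from
  `siegelLevel_smul` and uniqueness of continuous logarithms on the connected `ℍ`);
* `lambdaLog_smul` — `Λ_ψ(gτ) = ψ(δ) Λ_ψ(τ) + 2πi·W(g)` with the explicit constant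
  `W(g) = ∑_b ψ(b) (6 b²αβ/N + m_b(g))` (reindexing `b ↦ bα`, `ψ(α)⁻¹ = ψ(δ)`);
* `eisPeriod ψ M g = ∑_b ψ(b) (M·m_b(g) − m_b(g^{(M)}))` for `g ∈ Γ₀(NM)`, `g^{(M)} = (α, Mβ; γ/M, δ)`
  (`gamma0Conj`), a `ℤ`-linear combination of values of `ψ`, and
  **`psiLog_smul`**: `Ψ(gτ) = ψ(δ) Ψ(τ) + (2πi/M) · eisPeriod ψ M g` — the root-of-unity phases
  `6b²αβ/N` CANCEL between `g` and `g^{(M)}` (`β(g^{(M)}) = Mβ(g)`), so no denominator `N` survives;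
* `eisPeriod_mul` — the twisted cocycle law `P(gh) = P(g) + ψ(δ_g) P(h)` on `Γ₀(NM)`; on
  `Γ_H = {ψ(δ) = 1}` it is a homomorphism (`eisPeriod_mul_of`);
* `deriv_lambdaLog`, `deriv_psiLog` — for `ψ` primitive, even, `≠ 1`:
  `(Λ_ψ ∘ ofComplex)′ = −48πi · E₂^{𝟙,ψ}` and `(Ψ ∘ ofComplex)′(x) = −48πi (E(x) − E(Mx))`
  (`sum_character_mul_siegelG`), i.e. `−(24M)⁻¹ eisPeriod ψ M g = ∫_τ^{gτ} (E(z) − E(Mz)) dz` for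
  `g ∈ Γ_H`: the periods of the level-raised Eisenstein series are `ℤ[ψ]/(24M)`-valued.

This replaces, for weight `2`, the `q`-expansion-principle input of Billerey–Menares 2018 §3.2
(Mazur 1977 II.5–II.6 for `N = 1`: the periods of `dlog Δ(z)/Δ(Mz)`; Stevens 1982/1985 in general:
Eisenstein periods via modular units). Everything is proved; no named facts.

## References

* [KubertLang1981] D. S. Kubert, S. Lang, *Modular Units*, Grundlehren 244 (1981), Ch. 4 §1.
* [Mazur1977] B. Mazur, *Modular curves and the Eisenstein ideal*, Publ. Math. IHÉS 47 (1977),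
  II.5–II.6.
* [BillereyMenares2018] N. Billerey, R. Menares, Trans. AMS 370 (2018), §3.2.
* [DiamondShurman2005] F. Diamond, J. Shurman, GTM 228 (2005), §4.8.
-/

noncomputable section

open Complex Set Function Filter
open UpperHalfPlane hiding I
open scoped Real Topology MatrixGroups Manifold

namespace Literature.NumberTheory.ModularForms

open Literature.NumberTheory.EllipticCurves.ModularForms

local notation "ℍₒ" => upperHalfPlaneSet

namespace EisWt2

variable {N : ℕ} [NeZero N]

/-! ### Chosen logarithms of the units -/

/-- `N ∤ b.val` for `b ≠ 0` in `ZMod N`. [folklore] -/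
theorem not_dvd_val {b : ZMod N} (hb : b ≠ 0) : ¬ (N : ℤ) ∣ ((b.val : ℕ) : ℤ) := by
  intro h
  have h' : N ∣ b.val := Int.natCast_dvd_natCast.mp h
  have := Nat.eq_zero_of_dvd_of_lt h' (ZMod.val_lt b)
  exact hb ((ZMod.val_eq_zero b).mp this)

/-- **A chosen holomorphic logarithm `L_b` of the unit `𝒱_b`**, `b mod N` (`0` for `b = 0`).
[cite: KubertLang1981, Ch. 4 §1] -/
def unitLog (N : ℕ) [NeZero N] (b : ZMod N) : ℍ → ℂ :=
  if hb : b = 0 then 0 else (exists_mdifferentiable_log_siegelLevel (not_dvd_val hb)).choose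

/-- `L_b` is holomorphic. [folklore] -/
theorem mdifferentiable_unitLog (b : ZMod N) : MDiff (unitLog N b) := by
  unfold unitLog
  split_ifs with hb
  · exact mdifferentiable_const
  · exact (exists_mdifferentiable_log_siegelLevel (not_dvd_val hb)).choose_spec.1

/-- `L_b` is continuous. [folklore] -/
theorem continuous_unitLog (b : ZMod N) : Continuous (unitLog N b) :=
  (mdifferentiable_unitLog b).continuous

/-- `e^{L_b} = 𝒱_b` (`b ≠ 0`). [folklore] -/
theorem cexp_unitLog {b : ZMod N} (hb : b ≠ 0) (τ : ℍ) :
    cexp (unitLog N b τ) = siegelLevel N ((b.val : ℕ) : ℤ) τ := by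
  unfold unitLog
  rw [dif_neg hb]
  exact (exists_mdifferentiable_log_siegelLevel (not_dvd_val hb)).choose_spec.2 τ

/-- `(L_b ∘ ofComplex)′ = 2πi · 12 · G_{b}` (`b ≠ 0`). [folklore] -/
theorem deriv_unitLog {b : ZMod N} (hb : b ≠ 0) {x : ℂ} (hx : x ∈ ℍₒ) :
    deriv (unitLog N b ∘ ofComplex) x = 2 * π * I * 12 * siegelG N b.val x := by
  have h := deriv_log_siegelLevel_nat (N := N) (b := b.val)
    (Nat.pos_of_ne_zero fun h ↦ hb ((ZMod.val_eq_zero b).mp h)) (ZMod.val_lt b)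
    (mdifferentiable_unitLog b) (fun τ ↦ cexp_unitLog hb τ) hx
  exact h

/-! ### Units of `ZMod N` from `Γ₀(N)` -/

omit [NeZero N] in
/-- For `g ∈ Γ₀(N)`: `α δ = 1` in `ZMod N` (`αδ − βγ = 1`, `N ∣ γ`). [folklore] -/
theorem alpha_mul_delta {g : SL(2, ℤ)} (hg : (N : ℤ) ∣ g 1 0) :
    ((g 0 0 : ℤ) : ZMod N) * ((g 1 1 : ℤ) : ZMod N) = 1 := by
  have hdet := Matrix.det_fin_two (g : Matrix (Fin 2) (Fin 2) ℤ)
  rw [g.det_coe] at hdet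
  have h10 : ((g 1 0 : ℤ) : ZMod N) = 0 := by
    obtain ⟨c, hc⟩ := hg
    rw [hc]; push_cast; rw [ZMod.natCast_self, zero_mul]
  have h := congrArg (fun z : ℤ ↦ (z : ZMod N)) hdet
  simp only [Int.cast_one, Int.cast_sub, Int.cast_mul] at h
  rw [h10, mul_zero, sub_zero] at h
  exact h.symm

/-- The unit `α` of `ZMod N` attached to `g ∈ Γ₀(N)`. [folklore] -/
def alphaUnit {g : SL(2, ℤ)} (hg : (N : ℤ) ∣ g 1 0) : (ZMod N)ˣ :=
  ⟨((g 0 0 : ℤ) : ZMod N), ((g 1 1 : ℤ) : ZMod N), alpha_mul_delta hg,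
    by rw [mul_comm]; exact alpha_mul_delta hg⟩

omit [NeZero N] in
/-- `↑(alphaUnit) = α`. [folklore] -/
@[simp] theorem coe_alphaUnit {g : SL(2, ℤ)} (hg : (N : ℤ) ∣ g 1 0) :
    ((alphaUnit hg : (ZMod N)ˣ) : ZMod N) = ((g 0 0 : ℤ) : ZMod N) := rfl

omit [NeZero N] in
/-- `↑(alphaUnit⁻¹) = δ`. [folklore] -/
@[simp] theorem coe_alphaUnit_inv {g : SL(2, ℤ)} (hg : (N : ℤ) ∣ g 1 0) :
    (((alphaUnit hg)⁻¹ : (ZMod N)ˣ) : ZMod N) = ((g 1 1 : ℤ) : ZMod N) := rfl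

/-- `(b·α).val ≡ b.val·α (mod N)` as integers. [folklore] -/
theorem val_mul_alpha_modEq (b : ZMod N) (g : SL(2, ℤ)) :
    ((b.val : ℕ) : ℤ) * g 0 0 ≡ (((b * ((g 0 0 : ℤ) : ZMod N)).val : ℕ) : ℤ) [ZMOD N] := by
  rw [← ZMod.intCast_eq_intCast_iff]
  push_cast
  rw [ZMod.natCast_zmod_val, ZMod.natCast_zmod_val]

/-! ### Winding numbers `m_b(g)` -/

/-- **The transformation of the chosen logarithms**: for `g = (α β; γ δ) ∈ Γ₀(N)` and `b ≠ 0` there is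
an integer `m` with `L_b(gτ) = L_{bα}(τ) + 12πi(bβ)(bα)/N + 2πi·m` for all `τ`
(`siegelLevel_smul` + uniqueness of continuous logarithms on the connected `ℍ`).
[cite: KubertLang1981, Ch. 4 §1, Thm. 1.3] -/
theorem exists_unitLog_smul {b : ZMod N} (hb : b ≠ 0) (g : SL(2, ℤ)) (hg : (N : ℤ) ∣ g 1 0) :
    ∃ m : ℤ, ∀ τ : ℍ, unitLog N b (g • τ) =
      unitLog N (b * ((g 0 0 : ℤ) : ZMod N)) τ +
        12 * (π * I * (((b.val : ℕ) * g 0 1 : ℤ) * ((((b.val : ℕ) * g 0 0 : ℤ) : ℝ) / N : ℝ))) +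
        2 * π * I * m := by
  set b' : ZMod N := b * ((g 0 0 : ℤ) : ZMod N) with hb'def
  have hb' : b' ≠ 0 := by
    intro h0
    apply hb
    have : b = b' * (((alphaUnit hg)⁻¹ : (ZMod N)ˣ) : ZMod N) := by
      rw [hb'def, coe_alphaUnit_inv, mul_assoc, alpha_mul_delta hg, mul_one]
    rw [this, h0, zero_mul]
  -- the two continuous logarithms of `τ ↦ 𝒱_b(gτ)`
  have h₁ : Continuous fun τ : ℍ ↦ unitLog N b (g • τ) := by
    have hs : MDiff (fun τ : ℍ ↦ (g : GL (Fin 2) ℝ) • τ) :=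
      UpperHalfPlane.mdifferentiable_smul (by simp)
    exact ((mdifferentiable_unitLog b).comp hs).continuous
  have h₂ : Continuous fun τ : ℍ ↦ unitLog N b' τ +
      12 * (π * I * (((b.val : ℕ) * g 0 1 : ℤ) * ((((b.val : ℕ) * g 0 0 : ℤ) : ℝ) / N : ℝ))) :=
    (continuous_unitLog b').add continuous_const
  have he : ∀ τ : ℍ, cexp (unitLog N b (g • τ)) = cexp (unitLog N b' τ +
      12 * (π * I * (((b.val : ℕ) * g 0 1 : ℤ) * ((((b.val : ℕ) * g 0 0 : ℤ) : ℝ) / N : ℝ)))) := by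
    intro τ
    rw [cexp_unitLog hb, siegelLevel_smul N _ g hg τ, Complex.exp_add, cexp_unitLog hb',
      siegelLevel_congr N (val_mul_alpha_modEq b g) τ, mul_comm]
  obtain ⟨c, hc⟩ := exists_sub_eq_const_of_cexp_eq h₁ h₂ he
  -- `e^c = 1`
  have hc1 : cexp c = 1 := by
    have h := he UpperHalfPlane.I
    rw [hc UpperHalfPlane.I, Complex.exp_add _ c] at h
    have hne : cexp (unitLog N b' UpperHalfPlane.I +
        12 * (π * I * (((b.val : ℕ) * g 0 1 : ℤ) * ((((b.val : ℕ) * g 0 0 : ℤ) : ℝ) / N : ℝ)))) ≠ 0 :=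
      Complex.exp_ne_zero _
    calc cexp c = cexp (unitLog N b' UpperHalfPlane.I +
          12 * (π * I * (((b.val : ℕ) * g 0 1 : ℤ) * ((((b.val : ℕ) * g 0 0 : ℤ) : ℝ) / N : ℝ)))) *
            cexp c / cexp (unitLog N b' UpperHalfPlane.I +
          12 * (π * I * (((b.val : ℕ) * g 0 1 : ℤ) * ((((b.val : ℕ) * g 0 0 : ℤ) : ℝ) / N : ℝ)))) := by
          field_simp
      _ = 1 := by rw [h, div_self hne]
  obtain ⟨m, hm⟩ := Complex.exp_eq_one_iff.mp hc1
  refine ⟨m, fun τ ↦ ?_⟩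
  rw [hc τ, hm]
  ring

/-- **The winding number `m_b(g) ∈ ℤ`** of `𝒱_b` along `g ∈ Γ₀(N)` (`0` for `b = 0`).
[cite: KubertLang1981, Ch. 4 §1] -/
def unitWinding (b : ZMod N) (g : SL(2, ℤ)) (hg : (N : ℤ) ∣ g 1 0) : ℤ :=
  if hb : b = 0 then 0 else (exists_unitLog_smul hb g hg).choose

/-- The defining property of `m_b(g)`. [folklore] -/
theorem unitLog_smul {b : ZMod N} (hb : b ≠ 0) (g : SL(2, ℤ)) (hg : (N : ℤ) ∣ g 1 0) (τ : ℍ) :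
    unitLog N b (g • τ) = unitLog N (b * ((g 0 0 : ℤ) : ZMod N)) τ +
      12 * (π * I * (((b.val : ℕ) * g 0 1 : ℤ) * ((((b.val : ℕ) * g 0 0 : ℤ) : ℝ) / N : ℝ))) +
      2 * π * I * unitWinding b g hg := by
  unfold unitWinding
  rw [dif_neg hb]
  exact (exists_unitLog_smul hb g hg).choose_spec τ

/-! ### `Λ_ψ = ∑ ψ(b) L_b` and its transformation under `Γ₀(N)` -/

variable (ψ : DirichletCharacter ℂ N)

/-- **`Λ_ψ(τ) = ∑_{b mod N} ψ(b) L_b(τ)`**, a holomorphic function with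
`Λ_ψ′ = 2πi·12·∑ψ(b)G_b = −48πi E₂^{𝟙,ψ}`. [cite: DiamondShurman2005, §4.8] -/
def lambdaLog (τ : ℍ) : ℂ := ∑ b : ZMod N, ψ b * unitLog N b τ

/-- Unfolding lemma. [folklore] -/
theorem lambdaLog_def (τ : ℍ) : lambdaLog ψ τ = ∑ b : ZMod N, ψ b * unitLog N b τ := rfl

/-- `Λ_ψ` is holomorphic. [folklore] -/
theorem mdifferentiable_lambdaLog : MDiff (lambdaLog ψ) := by
  have : lambdaLog ψ = ∑ b : ZMod N, fun τ ↦ ψ b * unitLog N b τ := by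
    funext τ; simp [lambdaLog_def, Finset.sum_apply]
  rw [this]
  exact mdifferentiable_finset_sum _ fun b _ ↦ mdifferentiable_const.mul (mdifferentiable_unitLog b)

/-- `Λ_ψ` is continuous. [folklore] -/
theorem continuous_lambdaLog : Continuous (lambdaLog ψ) := (mdifferentiable_lambdaLog ψ).continuous

variable {ψ}

omit [NeZero N] in
/-- `ψ(0) = 0` when `N ≠ 1`. [folklore] -/
theorem map_zero_of_ne_one (hN1 : N ≠ 1) : ψ (0 : ZMod N) = 0 := by
  haveI : Nontrivial (ZMod N) := ZMod.nontrivial_iff.mpr hN1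
  exact ψ.map_nonunit not_isUnit_zero

/-- The constant `W(g) = ∑_b ψ(b)(6 b²αβ/N + m_b(g))` in `Λ_ψ(gτ) = ψ(δ)Λ_ψ(τ) + 2πi W(g)`
(`b` the representative in `[0, N)`). [folklore] -/
def lambdaConst (ψ : DirichletCharacter ℂ N) (g : SL(2, ℤ)) (hg : (N : ℤ) ∣ g 1 0) : ℂ :=
  ∑ b : ZMod N, ψ b * (6 * (((b.val : ℕ) : ℂ) ^ 2 * (g 0 0 : ℤ) * (g 0 1 : ℤ)) / N + unitWinding b g hg)

/-- Unfolding lemma. [folklore] -/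
theorem lambdaConst_def (g : SL(2, ℤ)) (hg : (N : ℤ) ∣ g 1 0) : lambdaConst ψ g hg =
    ∑ b : ZMod N, ψ b * (6 * (((b.val : ℕ) : ℂ) ^ 2 * (g 0 0 : ℤ) * (g 0 1 : ℤ)) / N +
      unitWinding b g hg) := rfl

/-- Reindexing `b ↦ bα`: `∑_b ψ(b) L_{bα} = ψ(δ) Λ_ψ`. [folklore] -/
theorem sum_character_mul_unitLog_mul (g : SL(2, ℤ)) (hg : (N : ℤ) ∣ g 1 0) (τ : ℍ) :
    ∑ b : ZMod N, ψ b * unitLog N (b * ((g 0 0 : ℤ) : ZMod N)) τ =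
      ψ ((g 1 1 : ℤ) : ZMod N) * lambdaLog ψ τ := by
  set u : (ZMod N)ˣ := alphaUnit hg with hu
  have hψb : ∀ b : ZMod N, ψ b = ψ ((g 1 1 : ℤ) : ZMod N) * ψ (b * ((g 0 0 : ℤ) : ZMod N)) := by
    intro b
    rw [← map_mul, show ((g 1 1 : ℤ) : ZMod N) * (b * ((g 0 0 : ℤ) : ZMod N)) =
      b * (((g 0 0 : ℤ) : ZMod N) * ((g 1 1 : ℤ) : ZMod N)) by ring, alpha_mul_delta hg, mul_one]
  calc ∑ b : ZMod N, ψ b * unitLog N (b * ((g 0 0 : ℤ) : ZMod N)) τ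
      = ∑ b : ZMod N, ψ ((g 1 1 : ℤ) : ZMod N) *
          (ψ (b * ((g 0 0 : ℤ) : ZMod N)) * unitLog N (b * ((g 0 0 : ℤ) : ZMod N)) τ) :=
        Finset.sum_congr rfl fun b _ ↦ by rw [hψb b]; ring
    _ = ψ ((g 1 1 : ℤ) : ZMod N) * ∑ b : ZMod N,
          (fun b' ↦ ψ b' * unitLog N b' τ) (Units.mulRight u b) := by
        rw [Finset.mul_sum]
        refine Finset.sum_congr rfl fun b _ ↦ ?_
        simp only [Units.mulRight_apply, hu, coe_alphaUnit]
    _ = ψ ((g 1 1 : ℤ) : ZMod N) * lambdaLog ψ τ := by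
        rw [Equiv.sum_comp (Units.mulRight u) (fun b' ↦ ψ b' * unitLog N b' τ), lambdaLog_def]

/-- **`Λ_ψ(gτ) = ψ(δ) Λ_ψ(τ) + 2πi·W(g)`** for `g = (α β; γ δ) ∈ Γ₀(N)`, `N ≠ 1`.
[cite: KubertLang1981, Ch. 4 §1] [cite: Mazur1977, II.5] -/
theorem lambdaLog_smul (hN1 : N ≠ 1) (g : SL(2, ℤ)) (hg : (N : ℤ) ∣ g 1 0) (τ : ℍ) :
    lambdaLog ψ (g • τ) = ψ ((g 1 1 : ℤ) : ZMod N) * lambdaLog ψ τ + 2 * π * I * lambdaConst ψ g hg := by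
  have hN : (N : ℂ) ≠ 0 := Nat.cast_ne_zero.mpr (NeZero.ne N)
  have hNr : (N : ℝ) ≠ 0 := Nat.cast_ne_zero.mpr (NeZero.ne N)
  have h0 := map_zero_of_ne_one (ψ := ψ) hN1
  -- termwise
  have hterm : ∀ b : ZMod N, ψ b * unitLog N b (g • τ) =
      ψ b * unitLog N (b * ((g 0 0 : ℤ) : ZMod N)) τ +
        2 * π * I * (ψ b * (6 * (((b.val : ℕ) : ℂ) ^ 2 * (g 0 0 : ℤ) * (g 0 1 : ℤ)) / N +
          unitWinding b g hg)) := by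
    intro b
    by_cases hb : b = 0
    · rw [hb, h0]; ring
    · rw [unitLog_smul hb g hg τ]
      push_cast
      field_simp
      ring
  rw [lambdaLog_def, Finset.sum_congr rfl fun b _ ↦ hterm b, Finset.sum_add_distrib,
    sum_character_mul_unitLog_mul g hg τ, lambdaConst_def, Finset.mul_sum]

/-- `N ≠ 1` for a non-trivial character. [folklore] -/
theorem level_ne_one (hψ1 : ψ ≠ 1) : N ≠ 1 := by
  rintro rfl
  exact hψ1 (DirichletCharacter.level_one ψ)

/-- `L_b ∘ ofComplex` is differentiable at the points of `ℍₒ`. [folklore] -/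
theorem differentiableAt_unitLog_comp (b : ZMod N) {x : ℂ} (hx : x ∈ ℍₒ) :
    DifferentiableAt ℂ (unitLog N b ∘ ofComplex) x :=
  ((UpperHalfPlane.mdifferentiable_iff.mp (mdifferentiable_unitLog b)) x hx).differentiableAt
    (isOpen_upperHalfPlaneSet.mem_nhds hx)

/-- `Λ_ψ ∘ ofComplex` is differentiable at the points of `ℍₒ`. [folklore] -/
theorem differentiableAt_lambdaLog_comp {x : ℂ} (hx : x ∈ ℍₒ) :
    DifferentiableAt ℂ (lambdaLog ψ ∘ ofComplex) x :=
  ((UpperHalfPlane.mdifferentiable_iff.mp (mdifferentiable_lambdaLog ψ)) x hx).differentiableAt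
    (isOpen_upperHalfPlaneSet.mem_nhds hx)

/-- **`(Λ_ψ ∘ ofComplex)′ = −48πi · E₂^{𝟙,ψ}`** for `ψ` primitive, even, `≠ 1`
(`deriv_unitLog` and `sum_character_mul_siegelG`). [cite: DiamondShurman2005, §4.8] -/
theorem deriv_lambdaLog (hψ : ψ.IsPrimitive) (hψ1 : ψ ≠ 1) (heven : ψ (-1) = 1) {x : ℂ}
    (hx : x ∈ ℍₒ) :
    deriv (lambdaLog ψ ∘ ofComplex) x = -(48 * π * I) * eisensteinE2Char ψ (ofComplex x) := by
  have hN1 := level_ne_one hψ1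
  have hd := fun b : ZMod N ↦ differentiableAt_unitLog_comp b hx
  have hfun : lambdaLog ψ ∘ ofComplex = ∑ b : ZMod N, fun y ↦ ψ b * (unitLog N b ∘ ofComplex) y := by
    funext y; simp [lambdaLog_def, Finset.sum_apply]
  rw [hfun, deriv_sum fun b _ ↦ (hd b).const_mul (ψ b)]
  have hterm : ∀ b : ZMod N, deriv (fun y ↦ ψ b * (unitLog N b ∘ ofComplex) y) x =
      2 * π * I * 12 * (ψ b * siegelG N b.val x) := by
    intro b
    rw [deriv_const_mul _ (hd b)]
    by_cases hb : b = 0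
    · rw [hb, map_zero_of_ne_one hN1]; ring
    · rw [deriv_unitLog hb hx]; ring
  rw [Finset.sum_congr rfl fun b _ ↦ hterm b, ← Finset.mul_sum, ofComplex_apply_of_im_pos hx]
  have h := sum_character_mul_siegelG ψ hψ hψ1 heven ⟨x, hx⟩
  rw [show (((⟨x, hx⟩ : ℍ) : ℂ)) = x from rfl] at h
  rw [h]
  ring

/-! ### `Ψ = Λ_ψ − M⁻¹ Λ_ψ(M·)` and the period cocycle on `Γ₀(NM)` -/

variable (ψ)
variable (M : ℕ) [NeZero M]

/-- **`Ψ(τ) = Λ_ψ(τ) − M⁻¹Λ_ψ(Mτ)`**, a primitive of `−48πi (E₂^{𝟙,ψ}(τ) − E₂^{𝟙,ψ}(Mτ))`.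
[cite: BillereyMenares2018, §3.2] -/
def psiLog (τ : ℍ) : ℂ := lambdaLog ψ τ - (M : ℂ)⁻¹ * lambdaLog ψ (mulNat M τ)

/-- Unfolding lemma. [folklore] -/
theorem psiLog_def (τ : ℍ) : psiLog ψ M τ = lambdaLog ψ τ - (M : ℂ)⁻¹ * lambdaLog ψ (mulNat M τ) := rfl

/-- `Mx ∈ ℍₒ` for `x ∈ ℍₒ`. [folklore] -/
theorem mul_mem_upperHalfPlaneSet {x : ℂ} (hx : x ∈ ℍₒ) : (M : ℂ) * x ∈ ℍₒ := by
  show 0 < ((M : ℂ) * x).im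
  rw [Complex.mul_im, Complex.natCast_re, Complex.natCast_im, zero_mul, add_zero]
  exact mul_pos (Nat.cast_pos.mpr (NeZero.pos M)) hx

/-- `M · ofComplex x = ofComplex (Mx)` on `ℍₒ`. [folklore] -/
theorem mulNat_ofComplex {x : ℂ} (hx : x ∈ ℍₒ) : mulNat M (ofComplex x) = ofComplex ((M : ℂ) * x) := by
  apply UpperHalfPlane.ext
  rw [coe_mulNat, ofComplex_apply_of_im_pos hx, ofComplex_apply_of_im_pos (mul_mem_upperHalfPlaneSet M hx)]

/-- **`(Ψ ∘ ofComplex)′(x) = −48πi (E₂^{𝟙,ψ}(x) − E₂^{𝟙,ψ}(Mx))`** for `ψ` primitive, even, `≠ 1`: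
`Ψ` is a primitive of `−48πi` times the level-raised Eisenstein series `E(z) − E(Mz)`.
[cite: BillereyMenares2018, §3.2] [cite: DiamondShurman2005, §4.8] -/
theorem deriv_psiLog (hψ : ψ.IsPrimitive) (hψ1 : ψ ≠ 1) (heven : ψ (-1) = 1) {x : ℂ}
    (hx : x ∈ ℍₒ) :
    deriv (psiLog ψ M ∘ ofComplex) x = -(48 * π * I) *
      (eisensteinE2Char ψ (ofComplex x) - eisensteinE2Char ψ (mulNat M (ofComplex x))) := by
  have hM : (M : ℂ) ≠ 0 := Nat.cast_ne_zero.mpr (NeZero.ne M)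
  have hxM := mul_mem_upperHalfPlaneSet M hx
  have hΛ := differentiableAt_lambdaLog_comp (ψ := ψ) hx
  have hΛM := differentiableAt_lambdaLog_comp (ψ := ψ) hxM
  -- the second piece is `(Λ ∘ ofComplex) ∘ (M·)` near `x`
  have heq : (fun y ↦ lambdaLog ψ (mulNat M (ofComplex y))) =ᶠ[𝓝 x]
      fun y ↦ (lambdaLog ψ ∘ ofComplex) ((M : ℂ) * y) := by
    filter_upwards [isOpen_upperHalfPlaneSet.mem_nhds hx] with y hy
    simp only [Function.comp_apply, mulNat_ofComplex M hy]
  have hcomp : HasDerivAt (fun y ↦ (lambdaLog ψ ∘ ofComplex) ((M : ℂ) * y))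
      (deriv (lambdaLog ψ ∘ ofComplex) ((M : ℂ) * x) * ((M : ℂ) * 1)) x :=
    hΛM.hasDerivAt.comp x ((hasDerivAt_id x).const_mul (M : ℂ))
  have hd2 : HasDerivAt (fun y ↦ lambdaLog ψ (mulNat M (ofComplex y)))
      (deriv (lambdaLog ψ ∘ ofComplex) ((M : ℂ) * x) * ((M : ℂ) * 1)) x :=
    hcomp.congr_of_eventuallyEq heq
  have hd1 : HasDerivAt (lambdaLog ψ ∘ ofComplex) (deriv (lambdaLog ψ ∘ ofComplex) x) x :=
    hΛ.hasDerivAt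
  have hfun : psiLog ψ M ∘ ofComplex =
      (lambdaLog ψ ∘ ofComplex) - fun y ↦ (M : ℂ)⁻¹ * lambdaLog ψ (mulNat M (ofComplex y)) := by
    funext y; simp [psiLog_def]
  rw [hfun, (hd1.sub (hd2.const_mul _)).deriv, deriv_lambdaLog hψ hψ1 heven hx,
    deriv_lambdaLog hψ hψ1 heven hxM, ← mulNat_ofComplex M hx]
  field_simp
  ring

omit [NeZero N] [NeZero M] in
/-- `M ∣ γ` for `g ∈ Γ₀(NM)`. [folklore] -/
theorem dvd_M_of_dvd_NM {g : SL(2, ℤ)} (hg : ((N * M : ℕ) : ℤ) ∣ g 1 0) : (M : ℤ) ∣ g 1 0 :=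
  (show (M : ℤ) ∣ ((N * M : ℕ) : ℤ) by push_cast; exact dvd_mul_left _ _).trans hg

omit [NeZero N] [NeZero M] in
/-- `N ∣ γ` for `g ∈ Γ₀(NM)`. [folklore] -/
theorem dvd_N_of_dvd_NM {g : SL(2, ℤ)} (hg : ((N * M : ℕ) : ℤ) ∣ g 1 0) : (N : ℤ) ∣ g 1 0 :=
  (show (N : ℤ) ∣ ((N * M : ℕ) : ℤ) by push_cast; exact dvd_mul_right _ _).trans hg

omit [NeZero N] in
/-- `N ∣ (g^{(M)})₁₀`. [folklore] -/
theorem dvd_N_gamma0Conj {g : SL(2, ℤ)} (hg : ((N * M : ℕ) : ℤ) ∣ g 1 0) :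
    (N : ℤ) ∣ (gamma0Conj M g (dvd_M_of_dvd_NM M hg)) 1 0 := by
  obtain ⟨c, hc⟩ := hg
  have hM : (M : ℤ) ≠ 0 := Int.natCast_ne_zero.mpr (NeZero.ne M)
  rw [gamma0Conj_apply_10, hc]
  refine ⟨c, ?_⟩
  push_cast
  rw [show (N : ℤ) * M * c = M * (N * c) by ring, Int.mul_ediv_cancel_left _ hM]

variable {ψ M}

/-- **The Eisenstein period** of `g ∈ Γ₀(NM)`:
`eisPeriod ψ M g = ∑_b ψ(b) (M·m_b(g) − m_b(g^{(M)}))`, a `ℤ`-linear combination of values of `ψ`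
(`= −24M ∫_τ^{gτ} (E(z) − E(Mz)) dz` when `ψ(δ_g) = 1`). [cite: Mazur1977, II.5–II.6]
[cite: BillereyMenares2018, §3.2] -/
def eisPeriod (ψ : DirichletCharacter ℂ N) (M : ℕ) [NeZero M] (g : SL(2, ℤ))
    (hg : ((N * M : ℕ) : ℤ) ∣ g 1 0) : ℂ :=
  ∑ b : ZMod N, ψ b * ((M : ℤ) * unitWinding b g (dvd_N_of_dvd_NM M hg) -
    unitWinding b (gamma0Conj M g (dvd_M_of_dvd_NM M hg)) (dvd_N_gamma0Conj M hg) : ℤ)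

/-- Unfolding lemma. [folklore] -/
theorem eisPeriod_def (g : SL(2, ℤ)) (hg : ((N * M : ℕ) : ℤ) ∣ g 1 0) : eisPeriod ψ M g hg =
    ∑ b : ZMod N, ψ b * ((M : ℤ) * unitWinding b g (dvd_N_of_dvd_NM M hg) -
      unitWinding b (gamma0Conj M g (dvd_M_of_dvd_NM M hg)) (dvd_N_gamma0Conj M hg) : ℤ) := rfl

/-- The phases cancel: `W(g) − W(g^{(M)})/M = M⁻¹ · eisPeriod` (`α(g^{(M)}) = α`, `β(g^{(M)}) = Mβ`).
[folklore] -/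
theorem lambdaConst_sub (g : SL(2, ℤ)) (hg : ((N * M : ℕ) : ℤ) ∣ g 1 0) :
    lambdaConst ψ g (dvd_N_of_dvd_NM M hg) -
      (M : ℂ)⁻¹ * lambdaConst ψ (gamma0Conj M g (dvd_M_of_dvd_NM M hg)) (dvd_N_gamma0Conj M hg) =
      (M : ℂ)⁻¹ * eisPeriod ψ M g hg := by
  have hM : (M : ℂ) ≠ 0 := Nat.cast_ne_zero.mpr (NeZero.ne M)
  rw [lambdaConst_def, lambdaConst_def, eisPeriod_def, Finset.mul_sum, Finset.mul_sum,
    ← Finset.sum_sub_distrib]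
  refine Finset.sum_congr rfl fun b _ ↦ ?_
  simp only [gamma0Conj_apply_00, gamma0Conj_apply_01]
  push_cast
  field_simp
  ring

/-- **`Ψ(gτ) = ψ(δ) Ψ(τ) + (2πi/M) · eisPeriod ψ M g`** for `g ∈ Γ₀(NM)` (`N ≠ 1`): the period
cocycle of the level-raised Eisenstein series is `(24M)⁻¹ℤ[ψ]`-valued.
[cite: Mazur1977, II.5–II.6] [cite: BillereyMenares2018, §3.2] -/
theorem psiLog_smul (hN1 : N ≠ 1) (g : SL(2, ℤ)) (hg : ((N * M : ℕ) : ℤ) ∣ g 1 0) (τ : ℍ) :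
    psiLog ψ M (g • τ) = ψ ((g 1 1 : ℤ) : ZMod N) * psiLog ψ M τ +
      2 * π * I * (M : ℂ)⁻¹ * eisPeriod ψ M g hg := by
  have hsub := lambdaConst_sub (ψ := ψ) g hg
  rw [psiLog_def, psiLog_def, mulNat_smul M g (dvd_M_of_dvd_NM M hg) τ,
    lambdaLog_smul hN1 g (dvd_N_of_dvd_NM M hg) τ,
    lambdaLog_smul hN1 (gamma0Conj M g (dvd_M_of_dvd_NM M hg)) (dvd_N_gamma0Conj M hg) (mulNat M τ),
    gamma0Conj_apply_11]
  linear_combination (2 * π * I) * hsub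

omit [NeZero N] [NeZero M] in
/-- `δ(gh) ≡ δ(g)δ(h)` modulo `N` on `Γ₀(NM)` (`(gh)₁₁ = g₁₀h₀₁ + g₁₁h₁₁`). [folklore] -/
theorem delta_mul {g : SL(2, ℤ)} (hg : ((N * M : ℕ) : ℤ) ∣ g 1 0) (h : SL(2, ℤ)) :
    (((g * h) 1 1 : ℤ) : ZMod N) = ((g 1 1 : ℤ) : ZMod N) * ((h 1 1 : ℤ) : ZMod N) := by
  have h10 : ((g 1 0 : ℤ) : ZMod N) = 0 := by
    obtain ⟨c, hc⟩ := dvd_N_of_dvd_NM M hg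
    rw [hc]; push_cast; rw [ZMod.natCast_self, zero_mul]
  have hmul : ((g * h) 1 1 : ℤ) = g 1 0 * h 0 1 + g 1 1 * h 1 1 := by
    rw [Matrix.SpecialLinearGroup.coe_mul, Matrix.mul_apply, Fin.sum_univ_two]
  rw [hmul]
  push_cast
  rw [h10, zero_mul, zero_add]

omit [NeZero N] [NeZero M] in
/-- `Γ₀(NM)` is closed under products (the `(1,0)` entry). [folklore] -/
theorem dvd_mul_apply_10 {g h : SL(2, ℤ)} (hg : ((N * M : ℕ) : ℤ) ∣ g 1 0)
    (hh : ((N * M : ℕ) : ℤ) ∣ h 1 0) : ((N * M : ℕ) : ℤ) ∣ (g * h) 1 0 := by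
  rw [Matrix.SpecialLinearGroup.coe_mul, Matrix.mul_apply, Fin.sum_univ_two]
  exact dvd_add (hg.mul_right _) (hh.mul_left _)

/-- **The twisted cocycle law** `P(gh) = P(g) + ψ(δ_g) P(h)` on `Γ₀(NM)` (`N ≠ 1`).
[cite: Mazur1977, II.5] -/
theorem eisPeriod_mul (hN1 : N ≠ 1) {g h : SL(2, ℤ)} (hg : ((N * M : ℕ) : ℤ) ∣ g 1 0)
    (hh : ((N * M : ℕ) : ℤ) ∣ h 1 0) :
    eisPeriod ψ M (g * h) (dvd_mul_apply_10 hg hh) =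
      eisPeriod ψ M g hg + ψ ((g 1 1 : ℤ) : ZMod N) * eisPeriod ψ M h hh := by
  have hM : (M : ℂ) ≠ 0 := Nat.cast_ne_zero.mpr (NeZero.ne M)
  have hpi : (2 * π * I : ℂ) ≠ 0 := by simp [Real.pi_ne_zero, Complex.I_ne_zero]
  have h1 := psiLog_smul (ψ := ψ) hN1 (g * h) (dvd_mul_apply_10 hg hh) UpperHalfPlane.I
  rw [mul_smul, psiLog_smul hN1 g hg, psiLog_smul hN1 h hh, delta_mul hg h, map_mul] at h1
  have key : 2 * π * I * (M : ℂ)⁻¹ * eisPeriod ψ M (g * h) (dvd_mul_apply_10 hg hh) =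
      2 * π * I * (M : ℂ)⁻¹ * (eisPeriod ψ M g hg + ψ ((g 1 1 : ℤ) : ZMod N) * eisPeriod ψ M h hh) := by
    linear_combination -h1
  have h2 := mul_left_cancel₀ (mul_ne_zero hpi (inv_ne_zero hM)) key
  exact h2

/-- On `Γ_H = {g ∈ Γ₀(NM) : ψ(δ_g) = 1}` the Eisenstein period is a homomorphism. [cite: Mazur1977, II.5] -/
theorem eisPeriod_mul_of (hN1 : N ≠ 1) {g h : SL(2, ℤ)} (hg : ((N * M : ℕ) : ℤ) ∣ g 1 0)
    (hh : ((N * M : ℕ) : ℤ) ∣ h 1 0) (hψg : ψ ((g 1 1 : ℤ) : ZMod N) = 1) :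
    eisPeriod ψ M (g * h) (dvd_mul_apply_10 hg hh) = eisPeriod ψ M g hg + eisPeriod ψ M h hh := by
  rw [eisPeriod_mul hN1 hg hh, hψg, one_mul]

end EisWt2

end Literature.NumberTheory.ModularForms

end
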